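import Summits.ResolutionOfSingularities.ResolutionOfSingularities.Theorems.RadicialJungCleanModelsCleanSpreadsDualDerivations
import Summits.ResolutionOfSingularities.ResolutionOfSingularities.Theorems.RadicialJungCleanModelsCleanSpreadsRegularTypeMechanism
import Literature.AlgebraicGeometry.Resolution.DerivativeIdealsLocalization
import Summits.ResolutionOfSingularities.ResolutionOfSingularities.Theorems.RadicialJungCleanModelsStubToroidalTwist
import Literature.AlgebraicGeometry.Resolution.StrictNormalCrossingsDescent
import HarnessLib

/-!
# Crux stmt-ResolutionOfSingularities-15917 (`RadicialJung.CleanModels`), stub `stub_cleanSpreads`,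
# part 3: spreading the toroidal form

Support file for the stub `stub_cleanSpreads` (line `Sketch`, rev 7), **case (i)**: on a finitely
generated `k`-domain `A` of characteristic `p` with `A_𝔭` regular (`𝔭` maximal), let
`x = u ∏_{i<m} a_i^{α_i}` be toroidal at `𝔭` (`u ∉ 𝔭`, `(a_i)` a regular system of parameters of
`A_𝔭` taken from `A`, `m ≥ 1`, `p ∤ α_i`). With `E_j ∈ Der(A)` dual to `a`
(`exists_derivations_dual_of_finiteType`): at a prime `𝔮` near `𝔭` containing none of the boundary
parameters, `a_0 E_0(x) = (∏ a_i^{α_i})(a_0 E_0 u + α_0 e u) ∉ 𝔮`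
(`mul_derivation_mul_prod_pow_eq`), so `x` is of regular type at `A_𝔮`; at a prime `𝔮` containing
some of them, those keep independent differentials at `A_𝔮` (`E_j a_i = e δ_ji` with the `E_j`
extended to `A_𝔮`) and extend to a regular system of parameters of `A_𝔮`
(`exists_extend_to_rsop`), so `x` is toroidal at `A_𝔮` with the same exponents
(`spreads_of_toroidal`).
-/

noncomputable section

set_option linter.dupNamespace false -- mandated namespace of this single-conjunct summit

open IsLocalRing Literature.AlgebraicGeometry.Resolution

namespace Summit.ResolutionOfSingularities.ResolutionOfSingularities.Theorems.RadicialJung.CleanModels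

universe u v w

/-! ## The toroidal form spreads -/

/-- The range of an appended family. -/
theorem range_fin_append_eq {M : Type*} {m n : ℕ} (u : Fin m → M) (v : Fin n → M) :
    Set.range (Fin.append u v) = Set.range u ∪ Set.range v := by
  ext z
  constructor
  · rintro ⟨i, rfl⟩
    refine Fin.addCases (fun j => ?_) (fun j => ?_) i
    · exact Or.inl ⟨j, (Fin.append_left u v j).symm⟩
    · exact Or.inr ⟨j, (Fin.append_right u v j).symm⟩
  · rintro (⟨j, rfl⟩ | ⟨j, rfl⟩)
    · exact ⟨Fin.castAdd n j, Fin.append_left u v j⟩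
    · exact ⟨Fin.natAdd m j, Fin.append_right u v j⟩

/-- The Leibniz computation of the toroidal case: if `E(a_{j₀}) = e` and `E` kills the other
boundary parameters, then
`a_{j₀} · E(u ∏ a_i^{α_i}) = (∏ a_i^{α_i}) · (a_{j₀} E(u) + α_{i₀} e u)`. -/
theorem mul_derivation_mul_prod_pow_eq {A : Type*} [CommRing A] (E : Derivation ℤ A A) {d m : ℕ}
    (hmd : m ≤ d) (a : Fin d → A) (α : Fin m → ℕ) (u e : A) (i₀ : Fin m) (hα : α i₀ ≠ 0)
    (hE : ∀ i : Fin m, E (a (Fin.castLE hmd i)) = if i = i₀ then e else 0) :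
    a (Fin.castLE hmd i₀) * E (u * ∏ i : Fin m, a (Fin.castLE hmd i) ^ α i) =
      (∏ i : Fin m, a (Fin.castLE hmd i) ^ α i) *
        (a (Fin.castLE hmd i₀) * E u + (α i₀ : A) * e * u) := by
  classical
  set P : A := ∏ i : Fin m, a (Fin.castLE hmd i) ^ α i with hP
  set Q : A := ∏ i ∈ Finset.univ.erase i₀, a (Fin.castLE hmd i) ^ α i with hQ
  have hprod : P = a (Fin.castLE hmd i₀) ^ α i₀ * Q := by
    rw [hP, ← Finset.mul_prod_erase Finset.univ _ (Finset.mem_univ i₀)]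
  have hEQ : E Q = 0 := by
    rw [hQ]
    refine Finset.prod_induction _ (fun z => E z = 0) ?_ ?_ ?_
    · intro z w hz hw
      rw [Derivation.leibniz, hz, hw, smul_zero, smul_zero, add_zero]
    · exact E.map_one_eq_zero
    · intro i hi
      rw [Derivation.leibniz_pow, hE, if_neg (Finset.ne_of_mem_erase hi), smul_zero, smul_zero]
  have hEP : a (Fin.castLE hmd i₀) * E P = (α i₀ : A) * e * P := by
    obtain ⟨β, hβ⟩ := Nat.exists_eq_succ_of_ne_zero hα
    rw [Nat.succ_eq_add_one] at hβ
    rw [hprod, Derivation.leibniz, hEQ, smul_zero, zero_add, Derivation.leibniz_pow, hE, if_pos rfl,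
      hβ, Nat.add_sub_cancel]
    simp only [smul_eq_mul, nsmul_eq_mul]
    push_cast
    ring
  calc a (Fin.castLE hmd i₀) * E (u * P)
      = u * (a (Fin.castLE hmd i₀) * E P) + P * (a (Fin.castLE hmd i₀) * E u) := by
        rw [Derivation.leibniz, smul_eq_mul, smul_eq_mul]; ring
    _ = P * (a (Fin.castLE hmd i₀) * E u + (α i₀ : A) * e * u) := by rw [hEP]; ring

/-- **Case (i): `x = u ∏_{i<m} a_i^{α_i}` toroidal at `v`.** With `E_j` dual to the regular system
of parameters `a` (`exists_derivations_dual_of_finiteType`): at a prime `𝔮` near `𝔭` containing none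
of the boundary parameters `a_i` (`i < m`), `a_0 E_0(s) = (∏ a_i^{α_i})(a_0 E_0 u + α_0 e u)` is
not in `𝔮`, so `x` is of regular type at `A_𝔮`; at a prime `𝔮` containing some of them, those have
independent differentials at `A_𝔮` (apply the extensions of the `E_j` to `A_𝔮`) and extend to a
regular system of parameters of `A_𝔮` (`exists_extend_to_rsop`), and `x` is toroidal at `A_𝔮` with
the same exponents. -/
theorem spreads_of_toroidal (k : Type u) [Field k] (p : ℕ) (hp : p.Prime) {A : Type u}
    [CommRing A] [IsDomain A] [CharP A p] [Algebra k A] [Algebra.FiniteType k A]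
    {K : Type w} [CommRing K] [Algebra A K] (𝔭 : Ideal A) [h𝔭 : 𝔭.IsMaximal]
    (O : Type v) [CommRing O] [Algebra A O] [IsLocalization.AtPrime O 𝔭] [IsRegularLocalRing O]
    (x : K) {d m : ℕ} (hmd : m ≤ d) (a : Fin d → A) (α : Fin m → ℕ) (u : A) (hu : u ∉ 𝔭)
    (ha : Ideal.span (Set.range fun i => algebraMap A O (a i)) = maximalIdeal O)
    (hd : ringKrullDim O = d) (hm : 0 < m) (hα : ∀ i, ¬ p ∣ α i)
    (hx : x = algebraMap A K (u * ∏ i : Fin m, a (Fin.castLE hmd i) ^ α i)) :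
    ∃ h : A, h ∉ 𝔭 ∧ ∀ (𝔮 : Ideal A) [𝔮.IsPrime], h ∉ 𝔮 → 𝔮 ≠ 𝔭 →
      ∀ (O' : Type v) [CommRing O'] [Algebra A O'] [IsLocalization.AtPrime O' 𝔮]
        [IsRegularLocalRing O'] [Algebra O' K] [IsScalarTower A O' K],
      ((∃ (d m : ℕ) (hmd : m ≤ d) (t : Fin d → O') (a : Fin m → ℕ) (u : O'), IsUnit u ∧
          Ideal.span (Set.range t) = maximalIdeal O' ∧
          ringKrullDim O' = (d : WithBot ℕ∞) ∧ 0 < m ∧ (∀ i, ¬ p ∣ a i) ∧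
          x = algebraMap O' K (u * ∏ i : Fin m, t (Fin.castLE hmd i) ^ (a i))) ∨
        (∃ u : O', IsUnit u ∧ x = algebraMap O' K u ∧
          ∀ c' : O', u - c' ^ p ∉ maximalIdeal O') ∨
        (∃ s c' : O', x = algebraMap O' K s ∧
          s - c' ^ p ∈ maximalIdeal O' ∧ s - c' ^ p ∉ maximalIdeal O' ^ 2)) := by
  classical
  haveI : Fact p.Prime := ⟨hp⟩
  obtain ⟨E, e, he, hE⟩ := exists_derivations_dual_of_finiteType k 𝔭 O a ha hd
  have ha𝔭 := mem_of_span_eq_maximalIdeal 𝔭 O a ha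
  set i₀ : Fin m := ⟨0, hm⟩ with hi₀
  set P : A := ∏ i : Fin m, a (Fin.castLE hmd i) ^ α i with hP
  set G : A := a (Fin.castLE hmd i₀) * E (Fin.castLE hmd i₀) u + (α i₀ : A) * e * u with hG
  have hαu : IsUnit ((α i₀ : ℕ) : A) := (CharP.isUnit_natCast_iff (R := A) hp).mpr (hα i₀)
  have hα0 : α i₀ ≠ 0 := fun h => hα i₀ (h ▸ dvd_zero p)
  have hEi : ∀ i : Fin m, E (Fin.castLE hmd i₀) (a (Fin.castLE hmd i)) =
      if i = i₀ then e else 0 := by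
    intro i
    rw [hE]
    by_cases h : i = i₀
    · subst h; simp
    · rw [if_neg (fun h' => h (Fin.castLE_injective hmd h').symm), if_neg h]
  have hEs : a (Fin.castLE hmd i₀) * E (Fin.castLE hmd i₀) (u * P) = P * G :=
    mul_derivation_mul_prod_pow_eq (E (Fin.castLE hmd i₀)) hmd a α u e i₀ hα0 hEi
  have hG𝔭 : G ∉ 𝔭 := by
    intro hG'
    have h1 : (α i₀ : A) * e * u ∈ 𝔭 := by
      have h2 := Ideal.sub_mem _ hG' (Ideal.mul_mem_right (E (Fin.castLE hmd i₀) u) _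
        (ha𝔭 (Fin.castLE hmd i₀)))
      rwa [hG, add_sub_cancel_left] at h2
    rcases h𝔭.isPrime.mem_or_mem h1 with h2 | h2
    · rcases h𝔭.isPrime.mem_or_mem h2 with h3 | h3
      · exact h𝔭.ne_top (Ideal.eq_top_of_isUnit_mem _ h3 hαu)
      · exact he h3
    · exact hu h2
  refine ⟨e * u * G, fun hmem => ?_, fun 𝔮 h𝔮 hq𝔮 _ O' _ _ _ _ _ _ => ?_⟩
  · rcases h𝔭.isPrime.mem_or_mem hmem with h1 | h1
    · rcases h𝔭.isPrime.mem_or_mem h1 with h2 | h2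
      · exact he h2
      · exact hu h2
    · exact hG𝔭 h1
  · have he𝔮 : e ∉ 𝔮 := fun h1 =>
      hq𝔮 (Ideal.mul_mem_right _ _ (Ideal.mul_mem_right _ _ h1))
    have hu𝔮 : u ∉ 𝔮 := fun h1 =>
      hq𝔮 (Ideal.mul_mem_right _ _ (Ideal.mul_mem_left _ _ h1))
    have hG𝔮 : G ∉ 𝔮 := fun h1 => hq𝔮 (Ideal.mul_mem_left _ _ h1)
    haveI : IsLocalRing O' := inferInstance
    by_cases hS : ∀ i : Fin m, a (Fin.castLE hmd i) ∉ 𝔮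
    · -- off the boundary: regular type
      have hP𝔮 : P ∉ 𝔮 := prod_pow_not_mem_of_isPrime h𝔮 _ _ _ fun i _ => hS i
      have hEs𝔮 : E (Fin.castLE hmd i₀) (u * P) ∉ 𝔮 := fun h1 => by
        have h2 : P * G ∈ 𝔮 := by rw [← hEs]; exact Ideal.mul_mem_left _ _ h1
        rcases h𝔮.mem_or_mem h2 with h3 | h3
        · exact hP𝔮 h3
        · exact hG𝔮 h3
      exact Or.inr (regularType_of_derivation_apply_notMem p hp (E (Fin.castLE hmd i₀)) (u * P) 𝔮
        hEs𝔮 x hx O')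
    · -- on the boundary: toroidal at `O'`
      push Not at hS
      set S' : Finset (Fin m) := Finset.univ.filter fun i => a (Fin.castLE hmd i) ∈ 𝔮 with hS'
      have hS'ne : S'.Nonempty := by
        obtain ⟨i, hi⟩ := hS
        exact ⟨i, Finset.mem_filter.mpr ⟨Finset.mem_univ i, hi⟩⟩
      have hr : 0 < S'.card := Finset.card_pos.mpr hS'ne
      let σ : Fin S'.card → Fin m := fun i => (S'.equivFin.symm i : Fin m)
      have hσmem : ∀ i, a (Fin.castLE hmd (σ i)) ∈ 𝔮 := fun i =>
        (Finset.mem_filter.mp (S'.equivFin.symm i).2).2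
      have hσinj : Function.Injective σ := Subtype.val_injective.comp S'.equivFin.symm.injective
      let fO : Fin S'.card → O' := fun i => algebraMap A O' (a (Fin.castLE hmd (σ i)))
      have hfm : ∀ i, fO i ∈ maximalIdeal O' := fun i =>
        (IsLocalization.AtPrime.to_map_mem_maximal_iff O' 𝔮 _).mpr (hσmem i)
      -- the extensions of the `E_j` to `O'`
      have hDex : ∀ j : Fin S'.card, ∃ D : Derivation ℤ O' O', ∀ z : A,
          D (algebraMap A O' z) = algebraMap A O' (E (Fin.castLE hmd (σ j)) z) := fun j =>
        exists_derivation_extend_of_isLocalization ℤ O' 𝔮.primeCompl (E _)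
      choose D hD using hDex
      have heu : IsUnit (algebraMap A O' e) :=
        (IsLocalization.AtPrime.isUnit_to_map_iff O' 𝔮 e).mpr he𝔮
      have hind : ∀ c : Fin S'.card → O', ∑ i, c i * fO i ∈ maximalIdeal O' ^ 2 →
          ∀ i, c i ∈ maximalIdeal O' := by
        intro c hc j
        have h1 : D j (∑ i, c i * fO i) ∈ maximalIdeal O' :=
          derivation_apply_mem_of_mem_sq (D j) _ hc
        have h3 : ∀ i, D j (fO i) = if j = i then algebraMap A O' e else 0 := by
          intro i
          change D j (algebraMap A O' _) = _
          rw [hD, hE]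
          by_cases hji : j = i
          · subst hji; simp
          · rw [if_neg (fun h' => hji (hσinj (Fin.castLE_injective hmd h'))), if_neg hji, map_zero]
        have h2 : D j (∑ i, c i * fO i) = c j * algebraMap A O' e + ∑ i, fO i * D j (c i) := by
          rw [map_sum]
          have h4 : ∀ i, D j (c i * fO i) = c i * D j (fO i) + fO i * D j (c i) := fun i => by
            rw [Derivation.leibniz, smul_eq_mul, smul_eq_mul]
          simp only [h4, Finset.sum_add_distrib, h3, mul_ite, mul_zero, Finset.sum_ite_eq,
            Finset.mem_univ, if_true]
        rw [h2] at h1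
        have h5 : ∑ i, fO i * D j (c i) ∈ maximalIdeal O' :=
          Ideal.sum_mem _ fun i _ => Ideal.mul_mem_right _ _ (hfm i)
        have h6 : c j * algebraMap A O' e ∈ maximalIdeal O' := (Ideal.add_mem_iff_left _ h5).mp h1
        exact (Ideal.mul_unit_mem_iff_mem _ heu).mp h6
      obtain ⟨e₀, y, hdim', hspan'⟩ := exists_extend_to_rsop fO hfm hind
      have happ : ∀ i : Fin S'.card,
          Fin.append fO y (Fin.castLE (Nat.le_add_right S'.card e₀) i) = fO i := fun i =>
        Fin.append_left' fO y i
      refine Or.inl ⟨S'.card + e₀, S'.card, Nat.le_add_right S'.card e₀, Fin.append fO y,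
        fun i => α (σ i),
        algebraMap A O' (u * ∏ i ∈ Finset.univ.filter (fun i => ¬ a (Fin.castLE hmd i) ∈ 𝔮),
          a (Fin.castLE hmd i) ^ α i), ?_, ?_, hdim', hr, fun i => hα (σ i), ?_⟩
      · refine (IsLocalization.AtPrime.isUnit_to_map_iff O' 𝔮 _).mpr fun hmem => ?_
        rcases h𝔮.mem_or_mem hmem with h1 | h1
        · exact hu𝔮 h1
        · exact prod_pow_not_mem_of_isPrime h𝔮 _ _ _ (fun i hi => (Finset.mem_filter.mp hi).2) h1
      · rw [range_fin_append_eq]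
        exact hspan'
      · rw [hx, IsScalarTower.algebraMap_apply A O' K]
        congr 1
        have hsplit : P = (∏ i ∈ S', a (Fin.castLE hmd i) ^ α i) *
            ∏ i ∈ Finset.univ.filter (fun i => ¬ a (Fin.castLE hmd i) ∈ 𝔮),
              a (Fin.castLE hmd i) ^ α i :=
          (Finset.prod_filter_mul_prod_filter_not _ _ _).symm
        have hS'prod : algebraMap A O' (∏ i ∈ S', a (Fin.castLE hmd i) ^ α i) =
            ∏ i : Fin S'.card, fO i ^ α (σ i) := by
          rw [map_prod, ← Finset.prod_coe_sort S', ← Equiv.prod_comp S'.equivFin.symm]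
          simp only [map_pow]
          rfl
        simp only [happ]
        rw [hsplit, map_mul, map_mul, map_mul, hS'prod]
        ring

end Summit.ResolutionOfSingularities.ResolutionOfSingularities.Theorems.RadicialJung.CleanModels

end
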